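import Summits.BirchSwinnertonDyer.BirchSwinnertonDyer.Theses.KatoDescentTamePotSupersingular
import Summits.BirchSwinnertonDyer.BirchSwinnertonDyer.Theorems.KatoDescentTamePotSupersingularTameUpperOptimalSharpNodesJ08S2MDLower
import Summits.BirchSwinnertonDyer.BirchSwinnertonDyer.Theorems.KatoDescentTamePotSupersingularJetchevIrreducibleReadingTwoSplit
import Summits.BirchSwinnertonDyer.BirchSwinnertonDyer.Theorems.KatoDescentTamePotSupersingularTameCoatesSujathaResidueOfKatoZeta
import Summits.BirchSwinnertonDyer.BirchSwinnertonDyer.Theorems.KatoDescentTamePotSupersingularTameUpperDefectOfSplit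
import Summits.BirchSwinnertonDyer.BirchSwinnertonDyer.Theorems.KatoDescentTamePotSupersingularTameUpperReducibleDefectOfCountInputs
import HarnessLib

/-!
# Route `KatoDescentTamePotSupersingular` (rung K8, sub-rung B4 (t′), cell `bsd-potss`): the U₀-ns node `TameUpperNonsurjTower`
# (item 19202) and U₀ `TameUpperDefectRankZero` (item 19982) BY NAME with the residual `TameRankOne` (item 19984) WEAKENED TO ITS
# LOWER HALF at the rank-one (t′) rows — U₀ bill v10 (seat `bsd-potss-k8t-c4` g16; `--supports stmt-BirchSwinnertonDyer-19982 --as helper`)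

WHAT. The node-by-name of record (`TameUpperNonsurjTowerOfNamedFacts.tameUpperNonsurjTower_of_structureIrred_of_namedFacts`,
p572191, consumed by the CLOSED glue 23137) and the U₀ bill v9 (`tameUpperDefectRankZero_of_leaves`, p613920) take the residual
`TameRankOne` — `MissingPPartAt` (BOTH halves of BSD_p) at every rank-one (t′) row. The road uses only its LOWER half (at the
Heegner twists): this seat's route-free sibling `TameUpperOptimalSharpNodesJ08S2MDLower` (p622578) proves the node body over the
schema `hRlow : ∀ W p, r_an(W) = 1 → p ≠ 2 → Addv W p → SubTprime W p → MissingLowerBoundAt W p`. This file restates the two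
by-name theorems over `hRlow`:
* §1 `tameUpperNonsurjTower_of_structureIrred_of_namedFacts_of_rankOneLower` — the node from the four named facts
  {MN19 Thm 0.7, Gross 3.7 (2), Poitou–Tate, GZ86 III (3.1)}, the held `PublishedInputsHeegner` / Cassels /
  `KatoTamagawaExactInputs` / `PublishedInputsFineSelmerCM`, the open Conj-A residue node `TameCoatesSujathaResidue`, and `hRlow`;
* §2 `tameUpperDefectRankZero_of_leaves_rankOneLower` — U₀ (item 19982) BY NAME from the same thirteen held leaves as bill v9, the
  crux `TameKatoZetaIndivisible` (24439) and `hRlow` in place of `TameRankOne` (19984).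
So, in the kernel and by name: **19982 ⟸ {13 held cite-level leaves} + 24439 (μ_p of Kato's zeta class = 0 on the residue rows)
+ the LOWER half `ord_p #Ш_an ≤ ord_p #Ш` at the rank-one (t′) rows** — the upper half of BSD_p at rank one is not an input of U₀.
HONEST LABEL: CONDITIONAL (both conclusions are route decls proved under displayed hypotheses; audit `proof.conditional`); the two
open inputs are open problems (Conj-A-type μ = 0; the lower half at rank one at an additive potentially supersingular prime — the
Skinner–Urban-side divisibility / p-adic Gross–Zagier step absent in print); closes NOTHING; BSD is proved for no curve.
[cite: Jetchev2008, Cor. 1.5 (p. 812)] [cite: MatarNekovar2019, Thm. 0.7, §0.11 (p. 457)] [cite: GrossLMS1991, Prop. 3.7 (2) (p. 240)]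
[cite: Manin1972, Cor. 3.6] [cite: Kato2004Asterisque, Thm. 14.5 (3) (p. 236), Prop. 14.16 (2) (p. 244)] [cite: MilneADT2006, Thm. I.7.3]
-/

set_option autoImplicit false
-- the Theorems directory repeats the summit name (sibling precedent `KatoDescentPotSupersingularAssembly.lean`)
set_option linter.dupNamespace false

noncomputable section

open scoped Classical NumberField

namespace Summit.BirchSwinnertonDyer.BirchSwinnertonDyer.Theorems.TameUpperNonsurjTowerOfNamedFactsLower

open WeierstrassCurve NumberField Literature.NumberTheory.EllipticCurves
  Literature.NumberTheory.EllipticCurves.ModularForms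
  Literature.NumberTheory.EllipticCurves.Rank1Residual
  Literature.NumberTheory.EllipticCurves.Rank1Residual.Typed
  Literature.NumberTheory.GaloisCohomology
  Summit.BirchSwinnertonDyer.Rank1Residual Summit.BirchSwinnertonDyer.Rank1Residual.Additive
  Summit.BirchSwinnertonDyer.BirchSwinnertonDyer.Theses.KatoDescentTamePotSupersingular
  Summit.BirchSwinnertonDyer.BirchSwinnertonDyer.Theorems

/-- **§1 The U₀-ns node `TameUpperNonsurjTower` (item 19202) BY NAME with the residual weakened to its LOWER half** — p572191's
`tameUpperNonsurjTower_of_structureIrred_of_namedFacts` with `(a84 : TameRankOne)` replaced by the lower-half schema `hRlow` at the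
rank-one (t′) rows; body = `TameUpperOptimalSharpNodesJ08S2MDLower.upperNonsurjTower_of_jetchev08TwoSplit_of_cruxAResidue_of_rankOneLower_of_maninDrinfeld`
over k9-c4 g11's two-split reading `JetchevIrreducibleSwapAtP.cor15_irreducibleReadingTwoSplit_of_namedFacts` (Kolyvagin and
newforms are conjuncts 2 and 4 of `PublishedInputsHeegner`). CONDITIONAL; closes nothing.
[cite: Jetchev2008, Cor. 1.5 (p. 812)] [cite: MatarNekovar2019, Thm. 0.7, §0.11 (p. 457)] [cite: GrossLMS1991, Prop. 3.7 (2) (p. 240)]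
[cite: Manin1972, Cor. 3.6] -/
theorem tameUpperNonsurjTower_of_structureIrred_of_namedFacts_of_rankOneLower
    (hS1 : MatarNekovar2019.thm07_padicValNat_card_sha_primary_add_le_of_globalDivisibility_of_irreducible)
    (h37 : GrossLMS1991.prop37_2_frobeniusCongruence)
    (hPT : ∀ (K : Type) [Field K] [NumberField K], poitouTate_selmerStructure_duality_conj K)
    (hF1 : Gross1991_heegnerPoint_sub_ratTorsion_mem_E0_imageFree)
    (hH : PublishedInputsHeegner) (hC₄ : PublishedInputCasselsIsogenyRedT) (hCS : TameCoatesSujathaResidue)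
    (hRlow : ∀ (W : WeierstrassCurve ℚ) [W.IsElliptic] [W.IsGloballyMinimal] (p : ℕ) [Fact p.Prime],
      W.analyticRank = 1 → p ≠ 2 → Addv W p → SubTprime W p → MissingLowerBoundAt W p)
    (a91 : KatoTamagawaExactInputs) (a87 : PublishedInputsFineSelmerCM) : TameUpperNonsurjTower :=
  TameUpperOptimalSharpNodesJ08S2MDLower.upperNonsurjTower_of_jetchev08TwoSplit_of_cruxAResidue_of_rankOneLower_of_maninDrinfeld
    (JetchevIrreducibleSwapAtP.cor15_irreducibleReadingTwoSplit_of_namedFacts hS1 h37 hPT hF1 hH.2.1 hH.2.2.2.1)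
    hH.1 hH.2.1 hH.2.2.1 hH.2.2.2.1 hH.2.2.2.2 hC₄ hCS hRlow a91 a87

/-- **§2 U₀ bill v10 — item 19982 `TameUpperDefectRankZero` BY NAME from the thirteen held cite-level leaves, the crux
`TameKatoZetaIndivisible` (24439) and the LOWER-half schema `hRlow` in place of the residual `TameRankOne` (19984)** — bill v9
(`tameUpperDefectRankZero_of_leaves`, p613920) with the residual weakened: the closed glue 19204 (`tameUpperDefectOfSplit_proof`) over
§1 (the helds `HeldMatarNekovarThm07` … `HeldGrossZagierE0ImageFree` ARE the four facts), the closed glue 24440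
(`tameCoatesSujathaResidueOfKatoZeta_proof`) for the Conj-A residue node, and the closed glue 19712
(`tameUpperReducibleDefectOfCountInputs_proof`, `𝐇¹` input = the tree theorem `PublishedInputIwasawaH1DataRedT_holds`) for U₀-red.
CONDITIONAL; closes nothing; BSD is proved for no curve. [cite: Kato2004Asterisque, Thm. 14.5 (3) (p. 236), Prop. 14.16 (2) (p. 244)]
[cite: Jetchev2008, Cor. 1.5 (p. 812)] [cite: MilneADT2006, Thm. I.7.3] -/
theorem tameUpperDefectRankZero_of_leaves_rankOneLower
    (hMN : HeldMatarNekovarThm07) (hG37 : HeldGrossProp37Two) (hPT : HeldPoitouTateSelmerDuality)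
    (hGZ : HeldGrossZagierE0ImageFree) (hH : PublishedInputsHeegner) (hC₄ : PublishedInputCasselsIsogenyRedT)
    (hZB : HeldKatoZetaBodyInputs) (hZI : TameKatoZetaIndivisible)
    (hRlow : ∀ (W : WeierstrassCurve ℚ) [W.IsElliptic] [W.IsGloballyMinimal] (p : ℕ) [Fact p.Prime],
      W.analyticRank = 1 → p ≠ 2 → Addv W p → SubTprime W p → MissingLowerBoundAt W p)
    (hK : KatoTamagawaExactInputs) (hF : PublishedInputsFineSelmerCM) (hN : PublishedInputNewformKatoRedT)
    (hM : PublishedInputMemberHullCountInputsT) (hRk : PublishedInputRankEqAnalyticRankRedT)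
    (hE : PublishedInputEntireLFunctionRedT) :
    TameUpperDefectRankZero :=
  tameUpperDefectOfSplit_proof
    (tameUpperNonsurjTower_of_structureIrred_of_namedFacts_of_rankOneLower hMN hG37 hPT hGZ hH hC₄
      (tameCoatesSujathaResidueOfKatoZeta_proof hZB hZI) hRlow hK hF)
    (tameUpperReducibleDefectOfCountInputs_proof PublishedInputIwasawaH1DataRedT_holds hN hM hC₄ hRk hE) hK

end Summit.BirchSwinnertonDyer.BirchSwinnertonDyer.Theorems.TameUpperNonsurjTowerOfNamedFactsLower

end
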